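import Literature.NumberTheory.Rogawski1990.RankOneUnstableDeltaValueRamifiedTame       -- ★ B-p10 (g26) R-4b (tame Cayley sign) ⊇ ★ R-4 p843425 (`localComponent_sub_one_eq_mul_hilbertSymbol`, Cayley parameter)
import Literature.NumberTheory.Rogawski1990.RankOneUnstableRamifiedSignCoherence       -- ★ A-p19 (g23) (R5b-σ): sign core + Cayley relation
import Literature.NumberTheory.Automorphic.RamifiedPlaceResidueFieldBridge              -- ★ A-p19 (g23) §3a: `isSquare_residue_toPlace_iff_of_ramified`
import Literature.NumberTheory.Rogawski1990.RankOneTorusRegularLocalConstancy           -- ★ A-p19 (g22) FILE B: `isUnit_frameDiff_of_isRegularElt` (regular ⇒ `τ₀ t − τ₁ t` a unit)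
import Literature.NumberTheory.Automorphic.RamifiedPlaceIntegerInvolution              -- ★ A-p19 (g23) R-0c: `isUnit_two_integer_of_v_two_eq_one`, `isUnit_integer_of_v_eq_one`
import HarnessLib

/-!
# R-4c⁺: `Δ` ALONG THE ELLIPTIC TORUS AT A TAMELY RAMIFIED PLACE, IN THE SIGNED-WINDOW FOLD'S SHAPE — ED. 1: the `μ`-part with a CHOSEN skew `η`
# (Rogawski 1990 §4.9 (4.9.2); Labesse–Langlands 1979 §2; road «R1-ram», architect A-p16 (g27) A-24 (b), (R5b-β) assembler F0P3a-p03 (g12) deal 10:50:13Z)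

Topic `NumberTheory/Rogawski1990`; namespace `Literature.NumberTheory.Rogawski1990`.  THEOREMS ONLY (no definition, no instance, no notation, no named fact, no `sorry`).
Cell `pub/hodgecm-mathlib` (D-0151), crux H413 = `stmt-HodgeConjecture-24833`, line «N6nsGerm» stub `stub_N6nsR1LL`, residue ★ `RankOneUnstableTransferNonsplitCMERamified` ⟸ ★ p843587
`rankOneUnstable_core_of_signedWindow` (binder `hΔ : Δ(t)·ε t = E t·(b^{(N t−1)∕2})⁻¹`).  HONEST LABEL: HC_CM is proved only modulo the printed citations (hLiu418, h413) until rung 0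
closes; this file is unconditional local algebra.

ED. 1 (this edition): **`exists_finHeckeValue_sub_inv_eq_mul_hilbertSymbol_of_skew`** — ★ B-p10's R-4 HEAD `exists_finHeckeValue_sub_inv_eq_mul_hilbertSymbol` with the skew element
`η` a PARAMETER instead of an existential (so the Cayley parameter `b₀` can be pinned to `η := ϖ_E · ι_w g`, `α_w = √θ_w`, and the (R5b-σ) Cayley relation ★ `cayley_unitPart_mul_eq`
applies): under print's guard `μ|_{𝕀_{L⁺}} = ω_{L∕L⁺}` there are a level `M₀` and `C = μ_w(2η) ≠ 0` with `μ_v(a − c)⁻¹ = μ_v(c)⁻¹ · C⁻¹ · (b₀, θ)_v` for all deep norm-one `c`, `a`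
and every `b₀` with `ι_w b₀ = (a_w∕c_w − 1)∕((a_w∕c_w + 1)·η)`.  Proof = B-p10's, verbatim, minus the choice of `η`.  ED. 2 (next): the torus reading `Δ(t)·εD t = μ_v(τ₁ t)⁻¹·E₀·((s₀q)^{(N t−1)∕2})⁻¹`.

## References
* [Rogawski1990] J. D. Rogawski, *Automorphic Representations of Unitary Groups in Three Variables* (1990): §4.9 Lemma 4.9.3 (4.9.2) p. 56; §4.9 p. 55.
* [LabesseLanglands1979] J.-P. Labesse, R. P. Langlands, *L-indistinguishability for SL(2)*, Canad. J. Math. 31 (1979): §2 (2.1)–(2.2).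
* [Serre1979] J.-P. Serre, *Local Fields* (1979): Ch. XIV §3.
-/

set_option autoImplicit false

noncomputable section

open NumberField IsDedekindDomain Filter Topology ValuativeRel
open scoped ValuativeRel

namespace Literature.NumberTheory.Rogawski1990

open Literature.NumberTheory.Automorphic Literature.NumberTheory.Automorphic.UnitaryGroup Literature.NumberTheory.GaloisRepresentations
open Literature.NumberTheory.QuadraticForms

section SkewParam

variable (L : Type) [Field L] [NumberField L] [IsCMField L] (v : HeightOneSpectrum (𝓞 ↥(maximalRealSubfield L)))
  (w : PlacesOver L v) (hw : IsCMField.complexConj L • w.1 = w.1) (μ : HeckeCharacter L)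
  (hμω : ∀ x : ideleGroup ↥(maximalRealSubfield L), μ (AdeleRing.ideleBaseChange ↥(maximalRealSubfield L) L x) = quadraticHeckeCharCM L x)

/-- `((b₀, θ)_v : ℂ)² = 1` (local copy of ★ R-4's private helper). [cite: Serre1979, Ch. XIV §3] -/
private theorem hilbertSymbol_cast_mul_self₁₅ {F : Type*} [Field F] (a b : F) : ((hilbertSymbol F a b : ℤ) : ℂ) * ((hilbertSymbol F a b : ℤ) : ℂ) = 1 := by
  unfold hilbertSymbol
  split_ifs <;> norm_num

include hw hμω in
/-- **THE `μ`-PART OF `Δ` WITH A CHOSEN SKEW `η`** (★ R-4 `exists_finHeckeValue_sub_inv_eq_mul_hilbertSymbol` with `η` a parameter): for every skew `η ≠ 0` (`σ_w η = −η`) there are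
`M₀ ≥ 1` and `C ≠ 0` (`C = μ_w(2η)`) such that for all `a, c ∈ L ⊗ L⁺_v` with `c` norm-one, DEEP (`|a_w − c_w| ≤ |2 ι_w ϖ_v^{M₀}|`), and every `b₀ ∈ L⁺_vˣ` with
`ι_w b₀ = (a_w∕c_w − 1)∕((a_w∕c_w + 1)·η)`: `μ_v(a − c)⁻¹ = μ_v(c)⁻¹ · C⁻¹ · (b₀, θ)_v`. [cite: Rogawski1990, §4.9 Lemma 4.9.3 (4.9.2) p. 56; §4.9 p. 55] [cite: LabesseLanglands1979, §2 (2.1)–(2.2)] -/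
theorem exists_finHeckeValue_sub_inv_eq_mul_hilbertSymbol_of_skew {η : w.1.adicCompletion L}
    (hση : galAdicCompletionMap (L := L) (IsCMField.complexConj L) hw η = -η) (hη0 : η ≠ 0) :
    ∃ (M₀ : ℕ) (C : ℂ), 1 ≤ M₀ ∧ C ≠ 0 ∧
      ∀ (a c : LocalRing L v) (b₀ : (v.adicCompletion ↥(maximalRealSubfield L))ˣ), conjLocal L (IsCMField.complexConj L) v c * c = 1 →
      Valued.v (a w - c w) ≤ Valued.v (2 * (toPlace v w (HeckeCharacter.uniformizer ↥(maximalRealSubfield L) v : v.adicCompletion ↥(maximalRealSubfield L))) ^ M₀) →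
      toPlace v w (b₀ : v.adicCompletion ↥(maximalRealSubfield L)) = (a w / c w - 1) / ((a w / c w + 1) * η) →
      (finHeckeValue L v μ (a - c))⁻¹ =
        (finHeckeValue L v μ c)⁻¹ * C⁻¹ *
          (hilbertSymbol (v.adicCompletion ↥(maximalRealSubfield L)) (b₀ : v.adicCompletion ↥(maximalRealSubfield L))
            (algebraMap ↥(maximalRealSubfield L) _ ((cmQuadraticGenerator L : 𝓞 ↥(maximalRealSubfield L)) : ↥(maximalRealSubfield L))) : ℂ) := by
  have _ := hση
  have hc1 : IsCMField.complexConj L ≠ 1 := IsCMField.complexConj_ne_one L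
  haveI hv : Subsingleton (PlacesOver L v) := PlacesOver.subsingleton_of_smul_eq (IsCMField.complexConj L) hc1 w hw
  have hinj : Function.Injective (algebraMap L (w.1.adicCompletion L)) := (algebraMap L (w.1.adicCompletion L)).injective
  haveI : CharZero (w.1.adicCompletion L) := charZero_of_injective_algebraMap hinj
  obtain ⟨M₀, hM₁, hM₀⟩ := exists_forall_localComponent_eq_one_of_valued_sub_one_le L v w μ
  have h2η : (2 : w.1.adicCompletion L) * η ≠ 0 := mul_ne_zero two_ne_zero hη0
  refine ⟨M₀, ((μ.localComponent w.1 (Units.mk0 (2 * η) h2η) : ℂˣ) : ℂ), hM₁, Units.ne_zero _, fun a c b₀ hc hdeep hb => ?_⟩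
  have hvc : Valued.v (c w) = 1 := valued_apply_eq_one_of_conjLocal_mul_self L v w hw hc
  have hc0 : c w ≠ 0 := fun h0 => by rw [h0, map_zero] at hvc; exact zero_ne_one hvc
  set z : w.1.adicCompletion L := a w / c w with hzdef
  have hzsub : z - 1 = (a w - c w) / c w := by rw [hzdef]; field_simp
  have hb0 : toPlace v w (b₀ : v.adicCompletion ↥(maximalRealSubfield L)) ≠ 0 := by
    rw [Ne, map_eq_zero_iff _ (toPlace v w).injective]
    exact b₀.ne_zero
  have hz1 : z - 1 ≠ 0 := by
    intro h0
    apply hb0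
    rw [hb, h0, zero_div]
  have hac0 : a w - c w ≠ 0 := by
    intro h0
    apply hz1
    rw [hzsub, h0, zero_div]
  have hdeep' : Valued.v (z - 1) ≤
      Valued.v (2 * (toPlace v w (HeckeCharacter.uniformizer ↥(maximalRealSubfield L) v : v.adicCompletion ↥(maximalRealSubfield L))) ^ M₀) := by
    rw [hzsub, Valuation.map_div, hvc, div_one]; exact hdeep
  have hcore := localComponent_sub_one_eq_mul_hilbertSymbol L v w hw μ hμω hη0 h2η hM₁ hM₀ hz1 hdeep' b₀ hb
  have hcne : c ≠ 0 := fun h0 => hc0 (by rw [h0, Pi.zero_apply])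
  have hacne : a - c ≠ 0 := fun h0 => hac0 (by rw [← Pi.sub_apply, h0, Pi.zero_apply])
  have hcu : IsUnit c := isUnit_localRing_of_ne_zero_of_subsingleton L v hv hcne
  have hacu : IsUnit (a - c) := isUnit_localRing_of_ne_zero_of_subsingleton L v hv hacne
  have hu1 : MulEquiv.piUnits hacu.unit w = Units.mk0 (c w) hc0 * Units.mk0 (z - 1) hz1 :=
    Units.ext (by
      rw [Units.val_mul, Units.val_mk0, Units.val_mk0, hzsub, mul_div_cancel₀ _ hc0]
      rfl)
  have hu2 : MulEquiv.piUnits hcu.unit w = Units.mk0 (c w) hc0 := Units.ext rfl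
  have hsinv : ((hilbertSymbol (v.adicCompletion ↥(maximalRealSubfield L)) (b₀ : v.adicCompletion ↥(maximalRealSubfield L))
      (algebraMap ↥(maximalRealSubfield L) _ ((cmQuadraticGenerator L : 𝓞 ↥(maximalRealSubfield L)) : ↥(maximalRealSubfield L))) : ℂ))⁻¹ =
      (hilbertSymbol (v.adicCompletion ↥(maximalRealSubfield L)) (b₀ : v.adicCompletion ↥(maximalRealSubfield L))
        (algebraMap ↥(maximalRealSubfield L) _ ((cmQuadraticGenerator L : 𝓞 ↥(maximalRealSubfield L)) : ↥(maximalRealSubfield L))) : ℂ) :=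
    inv_eq_of_mul_eq_one_left (hilbertSymbol_cast_mul_self₁₅ _ _)
  rw [finHeckeValue_eq_localComponent_of_nonsplit L v w hw μ hacu, finHeckeValue_eq_localComponent_of_nonsplit L v w hw μ hcu, hu1, hu2, map_mul,
    Units.val_mul, hcore, mul_inv, mul_inv, hsinv, mul_assoc]

end SkewParam

/-! ## §2 (ED. 2) THE TORUS READING: `Δ(t) · εD(t) = μ_v(τ₁ t)⁻¹ · E₀ · ((s₀ q)^{(N t − 1)∕2})⁻¹` at a TAMELY RAMIFIED place -/

section Torus

variable (L : Type) [Field L] [NumberField L] [IsCMField L] (v : HeightOneSpectrum (𝓞 ↥(maximalRealSubfield L)))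

/-- in `ℤₘ₀`: `x ^ 2 = y ^ 2 ⇒ x = y`. [folklore] -/
private theorem eq_of_sq_eq_sq₁₅ {x y : WithZero (Multiplicative ℤ)} (h : x ^ 2 = y ^ 2) : x = y := by
  rcases lt_trichotomy x y with hxy | hxy | hxy
  · exact absurd h (pow_lt_pow_left₀ hxy zero_le two_ne_zero).ne
  · exact hxy
  · exact absurd h (pow_lt_pow_left₀ hxy zero_le two_ne_zero).ne'

set_option maxHeartbeats 800000 in
open scoped Classical in
/-- **R-4c⁺ — `Δ` ALONG THE ELLIPTIC TORUS AT A TAMELY RAMIFIED PLACE, IN THE SIGNED-WINDOW FOLD'S `hΔ` SHAPE, WITH THE D-SIDE SIGN FOLDED IN.**  Data: a tamely ramified non-split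
`w ∣ v` (`e(w|v) ≠ 1`, `|2|_w = 1`), `μ` under print's guard, a unit `θ₀ ∈ 𝒪[L_w]` (the diagonal-unit Gram value of the D-side, A-p01 R2-D), and an elliptic regular frame
`(t₀, P, d)` of `H_v`.  THEN there are a skew uniformiser `ϖ_E` of `L_w` (★ R-4b: `ι_w π = ϖ_E²` for a uniformiser `π` of `L⁺_v`), a level `N₁` and a constant `E₀ ≠ 0` such that
for EVERY sign function `εD` on the torus satisfying the D-SIDE SPEC «`εD t = [res S]` whenever `↑S = c_w · u_t · θ₀`» (`c = τ₁ t`, `u_t := (τ₀ t − τ₁ t)_w · ϖ_E^{−N t}` the unit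
part of `a − c`, `[x] := if IsSquare x then 1 else −1`; the (R5b-α) bit of ★ B-p12 FILE 5 has this shape), and every regular `t ∈ Z(t₀)` with `N t ≥ N₁`:
**`Δ(t) · εD t = μ_v(τ₁ t)⁻¹ · E₀ · ((s₀ · q)^{(N t − 1)∕2})⁻¹`**, `s₀ = [res_w (−1)] = (−1, π)_v` (pinned literal), `q = |𝓞_{L⁺}∕v|`, `N t = (−log|τ₀ t − τ₁ t|_w)`, `Δ(t) = μ_v(τ₀ t − τ₁ t)⁻¹ · √(∏‖τ₀ t − τ₁ t‖)`
(★ L1's tokens).  Chain: §1 at `η := ϖ_E` ∘ ★ `exists_units_toPlace_eq_cayley_div` (Cayley parameter `b₀`, `|b₀|_v = |π|^k`, `N t = 2k + 1` — odd because `|ι_w b₀|_w` is a square)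
∘ ★ R-4b (`(b₀,θ_v) = (b₀,π) = s₀^k (β₀,π)`, `(β₀,π) = [res_v β₀]`) ∘ ★ bridge (`= [res_w ι_w β₀]`) ∘ ★ `cayley_unitPart_mul_eq` + ★ `ite_isSquare_residue_mul_neg_one_pow_eq_of_cayley`
(`[res_w ι_w β₀]·εD t = [res (2θ₀)]`) ∘ ★ `sqrt_prod_norm_eq_of_log_eq_neg_odd` (`√∏ = q^{−k} q^{−1∕2}`); `E₀ = C⁻¹ q^{−1∕2} [res (2θ₀)]`.
[cite: Rogawski1990, §4.9 Lemma 4.9.3 (4.9.2) p. 56] [cite: LabesseLanglands1979, §2 (2.1)–(2.2), p. 9] [cite: Serre1979, Ch. XIV §3] -/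
theorem exists_rankOneDelta_mul_sign_eq_of_ramified_tame (w : PlacesOver L v) (hw : IsCMField.complexConj L • w.1 = w.1)
    (he : v.asIdeal.ramificationIdx' w.1.asIdeal ≠ 1) (h2 : Valued.v (2 : w.1.adicCompletion L) = 1) (μ : HeckeCharacter L)
    (hμω : ∀ x : ideleGroup ↥(maximalRealSubfield L), μ (AdeleRing.ideleBaseChange ↥(maximalRealSubfield L) L x) = quadraticHeckeCharCM L x)
    (θ₀ : 𝒪[(w.1.adicCompletion L)]) (hθ₀ : IsUnit θ₀)
    (t₀ : ((cmDatum L 2 (Matrix.of fun i j : Fin 2 => if i.val + j.val + 1 = 2 then (1 : L) else 0)).Local v × (cmDatum L 1 (Matrix.of fun i j : Fin 1 => if i.val + j.val + 1 = 1 then (1 : L) else 0)).Local v)) (P : GL (Fin 2) (LocalRing L v)) (d : Fin 2 → (LocalRing L v)) (ht₀ : IsRegularElt (t₀.1.val : GL (Fin 2) (LocalRing L v)))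
    (hP : (t₀.1.val.val : Matrix (Fin 2) (Fin 2) (LocalRing L v)) * P.val = P.val * Matrix.diagonal d) (hd1 : ∀ i, conjLocal L (IsCMField.complexConj L) v (d i) * d i = 1) :
    ∃ (ϖE : ((w.1.adicCompletion L))ˣ) (N₁ : ℕ) (E₀ : ℂ),
      Valued.v (ϖE : (w.1.adicCompletion L)) = WithZero.exp (-1 : ℤ) ∧ (galAdicCompletionMap (L := L) (IsCMField.complexConj L) hw) ϖE = -ϖE ∧ E₀ ≠ 0 ∧
      ∀ (εD : ↥(Subgroup.centralizer ({t₀} : Set ((cmDatum L 2 (Matrix.of fun i j : Fin 2 => if i.val + j.val + 1 = 2 then (1 : L) else 0)).Local v × (cmDatum L 1 (Matrix.of fun i j : Fin 1 => if i.val + j.val + 1 = 1 then (1 : L) else 0)).Local v))) → ℂ),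
        (∀ t : ↥(Subgroup.centralizer ({t₀} : Set ((cmDatum L 2 (Matrix.of fun i j : Fin 2 => if i.val + j.val + 1 = 2 then (1 : L) else 0)).Local v × (cmDatum L 1 (Matrix.of fun i j : Fin 1 => if i.val + j.val + 1 = 1 then (1 : L) else 0)).Local v))), IsRegularElt ((t : ((cmDatum L 2 (Matrix.of fun i j : Fin 2 => if i.val + j.val + 1 = 2 then (1 : L) else 0)).Local v × (cmDatum L 1 (Matrix.of fun i j : Fin 1 => if i.val + j.val + 1 = 1 then (1 : L) else 0)).Local v)).1.val : GL (Fin 2) (LocalRing L v)) → ∀ S : 𝒪[(w.1.adicCompletion L)],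
          (S : (w.1.adicCompletion L)) = (((P⁻¹).val * ((t : ((cmDatum L 2 (Matrix.of fun i j : Fin 2 => if i.val + j.val + 1 = 2 then (1 : L) else 0)).Local v × (cmDatum L 1 (Matrix.of fun i j : Fin 1 => if i.val + j.val + 1 = 1 then (1 : L) else 0)).Local v)).1.val.val : Matrix (Fin 2) (Fin 2) (LocalRing L v)) * P.val) 1 1) w * ((((P⁻¹).val * ((t : ((cmDatum L 2 (Matrix.of fun i j : Fin 2 => if i.val + j.val + 1 = 2 then (1 : L) else 0)).Local v × (cmDatum L 1 (Matrix.of fun i j : Fin 1 => if i.val + j.val + 1 = 1 then (1 : L) else 0)).Local v)).1.val.val : Matrix (Fin 2) (Fin 2) (LocalRing L v)) * P.val) 0 0 - ((P⁻¹).val * ((t : ((cmDatum L 2 (Matrix.of fun i j : Fin 2 => if i.val + j.val + 1 = 2 then (1 : L) else 0)).Local v × (cmDatum L 1 (Matrix.of fun i j : Fin 1 => if i.val + j.val + 1 = 1 then (1 : L) else 0)).Local v)).1.val.val : Matrix (Fin 2) (Fin 2) (LocalRing L v)) * P.val) 1 1) w * ((ϖE : (w.1.adicCompletion L)) ^ (-WithZero.log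 (Valued.v ((((P⁻¹).val * ((t : ((cmDatum L 2 (Matrix.of fun i j : Fin 2 => if i.val + j.val + 1 = 2 then (1 : L) else 0)).Local v × (cmDatum L 1 (Matrix.of fun i j : Fin 1 => if i.val + j.val + 1 = 1 then (1 : L) else 0)).Local v)).1.val.val : Matrix (Fin 2) (Fin 2) (LocalRing L v)) * P.val) 0 0 - ((P⁻¹).val * ((t : ((cmDatum L 2 (Matrix.of fun i j : Fin 2 => if i.val + j.val + 1 = 2 then (1 : L) else 0)).Local v × (cmDatum L 1 (Matrix.of fun i j : Fin 1 => if i.val + j.val + 1 = 1 then (1 : L) else 0)).Local v)).1.val.val : Matrix (Fin 2) (Fin 2) (LocalRing L v)) * P.val) 1 1) w))).toNat)⁻¹) * (θ₀ : (w.1.adicCompletion L)) →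
          εD t = if IsSquare (IsLocalRing.residue 𝒪[(w.1.adicCompletion L)] S) then (1 : ℂ) else -1) →
        ∀ t : ↥(Subgroup.centralizer ({t₀} : Set ((cmDatum L 2 (Matrix.of fun i j : Fin 2 => if i.val + j.val + 1 = 2 then (1 : L) else 0)).Local v × (cmDatum L 1 (Matrix.of fun i j : Fin 1 => if i.val + j.val + 1 = 1 then (1 : L) else 0)).Local v))), IsRegularElt ((t : ((cmDatum L 2 (Matrix.of fun i j : Fin 2 => if i.val + j.val + 1 = 2 then (1 : L) else 0)).Local v × (cmDatum L 1 (Matrix.of fun i j : Fin 1 => if i.val + j.val + 1 = 1 then (1 : L) else 0)).Local v)).1.val : GL (Fin 2) (LocalRing L v)) → N₁ ≤ (-WithZero.log (Valued.v ((((P⁻¹).val * ((t : ((cmDatum L 2 (Matrix.of fun i j : Fin 2 => if i.val + j.val + 1 = 2 then (1 : L) else 0)).Local v × (cmDatum L 1 (Matrix.of fun i j : Fin 1 => if i.val + j.val + 1 = 1 then (1 : L) else 0)).Local v)).1.val.val : Matrix (Fin 2) (Fin 2) (LocalRing L v)) * P.val) 0 0 - ((P⁻¹).val * ((t : ((cmDatum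 L 2 (Matrix.of fun i j : Fin 2 => if i.val + j.val + 1 = 2 then (1 : L) else 0)).Local v × (cmDatum L 1 (Matrix.of fun i j : Fin 1 => if i.val + j.val + 1 = 1 then (1 : L) else 0)).Local v)).1.val.val : Matrix (Fin 2) (Fin 2) (LocalRing L v)) * P.val) 1 1) w))).toNat →
          ((finHeckeValue L v μ (((P⁻¹).val * ((t : ((cmDatum L 2 (Matrix.of fun i j : Fin 2 => if i.val + j.val + 1 = 2 then (1 : L) else 0)).Local v × (cmDatum L 1 (Matrix.of fun i j : Fin 1 => if i.val + j.val + 1 = 1 then (1 : L) else 0)).Local v)).1.val.val : Matrix (Fin 2) (Fin 2) (LocalRing L v)) * P.val) 0 0 - ((P⁻¹).val * ((t : ((cmDatum L 2 (Matrix.of fun i j : Fin 2 => if i.val + j.val + 1 = 2 then (1 : L) else 0)).Local v × (cmDatum L 1 (Matrix.of fun i j : Fin 1 => if i.val + j.val + 1 = 1 then (1 : L) else 0)).Local v)).1.val.val : Matrix (Fin 2) (Fin 2) (LocalRing L v)) * P.val) 1 1))⁻¹ : ℂ) *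
          ((Real.sqrt (∏ w' : PlacesOver L v, ‖(((P⁻¹).val * ((t : ((cmDatum L 2 (Matrix.of fun i j : Fin 2 => if i.val + j.val + 1 = 2 then (1 : L) else 0)).Local v × (cmDatum L 1 (Matrix.of fun i j : Fin 1 => if i.val + j.val + 1 = 1 then (1 : L) else 0)).Local v)).1.val.val : Matrix (Fin 2) (Fin 2) (LocalRing L v)) * P.val) 0 0 - ((P⁻¹).val * ((t : ((cmDatum L 2 (Matrix.of fun i j : Fin 2 => if i.val + j.val + 1 = 2 then (1 : L) else 0)).Local v × (cmDatum L 1 (Matrix.of fun i j : Fin 1 => if i.val + j.val + 1 = 1 then (1 : L) else 0)).Local v)).1.val.val : Matrix (Fin 2) (Fin 2) (LocalRing L v)) * P.val) 1 1) w'‖) : ℝ) : ℂ) * εD t =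
            (finHeckeValue L v μ (((P⁻¹).val * ((t : ((cmDatum L 2 (Matrix.of fun i j : Fin 2 => if i.val + j.val + 1 = 2 then (1 : L) else 0)).Local v × (cmDatum L 1 (Matrix.of fun i j : Fin 1 => if i.val + j.val + 1 = 1 then (1 : L) else 0)).Local v)).1.val.val : Matrix (Fin 2) (Fin 2) (LocalRing L v)) * P.val) 1 1))⁻¹ * E₀ *
              (((if IsSquare (IsLocalRing.residue 𝒪[(w.1.adicCompletion L)] (-1)) then (1 : ℂ) else -1) * (Nat.card (𝓞 ↥(maximalRealSubfield L) ⧸ v.asIdeal) : ℂ)) ^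
                (((-WithZero.log (Valued.v ((((P⁻¹).val * ((t : ((cmDatum L 2 (Matrix.of fun i j : Fin 2 => if i.val + j.val + 1 = 2 then (1 : L) else 0)).Local v × (cmDatum L 1 (Matrix.of fun i j : Fin 1 => if i.val + j.val + 1 = 1 then (1 : L) else 0)).Local v)).1.val.val : Matrix (Fin 2) (Fin 2) (LocalRing L v)) * P.val) 0 0 - ((P⁻¹).val * ((t : ((cmDatum L 2 (Matrix.of fun i j : Fin 2 => if i.val + j.val + 1 = 2 then (1 : L) else 0)).Local v × (cmDatum L 1 (Matrix.of fun i j : Fin 1 => if i.val + j.val + 1 = 1 then (1 : L) else 0)).Local v)).1.val.val : Matrix (Fin 2) (Fin 2) (LocalRing L v)) * P.val) 1 1) w))).toNat - 1) / 2))⁻¹ := by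
  classical
  have hc1 : IsCMField.complexConj L ≠ 1 := IsCMField.complexConj_ne_one L
  haveI hv : Subsingleton (PlacesOver L v) := PlacesOver.subsingleton_of_smul_eq (IsCMField.complexConj L) hc1 w hw
  haveI := PlacesOver.liesOver (E := L) w
  have he2 : v.asIdeal.ramificationIdx' w.1.asIdeal = 2 := Liu2021.LemD1IndexedNonVacuityRamifiedPlace.ramificationIdx'_eq_two_of_ne_one L v (IsCMField.complexConj L) hc1 w hw he
  -- the skew uniformiser and `π` of ★ R-4b, with `(x, θ_v) = (x, π)`
  obtain ⟨π, ϖE, hπ, hσϖE, hιπ, hsymb⟩ := hilbertSymbol_cmQuadraticGenerator_eq_of_ramified L w hw he h2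
  have hπ0 : π ≠ 0 := fun h0 => by rw [h0, map_zero] at hπ; exact WithZero.coe_ne_zero hπ.symm
  have hϖE0 : (ϖE : (w.1.adicCompletion L)) ≠ 0 := ϖE.ne_zero
  have hϖEv : Valued.v (ϖE : (w.1.adicCompletion L)) = WithZero.exp (-1 : ℤ) := by
    have h1 : Valued.v (toPlace v w π) = Valued.v (ϖE : (w.1.adicCompletion L)) ^ 2 := by rw [hιπ, map_pow]
    rw [valued_toPlace, he2, hπ] at h1
    exact (eq_of_sq_eq_sq₁₅ h1).symm
  -- §1 at `η := ϖE`
  obtain ⟨M₀, C, hM₁, hC0, hcore⟩ := exists_finHeckeValue_sub_inv_eq_mul_hilbertSymbol_of_skew L v w hw μ hμω hσϖE hϖE0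
  -- tameness on the base: `|2|_v = 1`, `2 ∈ 𝒪_vˣ`
  have h2v : Valued.v (2 : v.adicCompletion ↥(maximalRealSubfield L)) = 1 := by
    have h := h2
    rw [show (2 : (w.1.adicCompletion L)) = toPlace v w 2 from (map_ofNat _ 2).symm, valued_toPlace, he2] at h
    exact eq_of_sq_eq_sq₁₅ (by rw [h, one_pow])
  have h2O : IsUnit (2 : Valued.integer (v.adicCompletion ↥(maximalRealSubfield L))) :=
    (Valuation.integer.integers (Valued.v (R := v.adicCompletion ↥(maximalRealSubfield L)))).isUnit_iff_valuation_eq_one.2 h2v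
  have h2Ow : IsUnit (2 : 𝒪[(w.1.adicCompletion L)]) := isUnit_two_integer_of_v_two_eq_one w.1 h2
  -- the constant `E₀ = C⁻¹ · q^{−1∕2} · [res (2θ₀)]`
  have hq0 : 0 < Nat.card (𝓞 ↥(maximalRealSubfield L) ⧸ v.asIdeal) := Nat.card_pos
  have hE₀ : C⁻¹ * (((Real.sqrt (Nat.card (𝓞 ↥(maximalRealSubfield L) ⧸ v.asIdeal) : ℝ))⁻¹ : ℝ) : ℂ) *
      (if IsSquare (IsLocalRing.residue 𝒪[(w.1.adicCompletion L)] (2 * θ₀)) then (1 : ℂ) else -1) ≠ 0 := by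
    refine mul_ne_zero (mul_ne_zero (inv_ne_zero hC0) ?_) ?_
    · exact_mod_cast inv_ne_zero ((Real.sqrt_pos.2 (by positivity)).ne')
    · split_ifs <;> norm_num
  -- `s₀ = (−1, π)_v = [res_w (−1)]` (the architect's pinned literal, A-p16 (g28) P1), named `sI` ONCE (keeps `ite` atoms out of `isDefEq`)
  obtain ⟨sI, hsI⟩ : ∃ sI : ℂ, (if IsSquare (IsLocalRing.residue 𝒪[(w.1.adicCompletion L)] (-1)) then (1 : ℂ) else -1) = sI := ⟨_, rfl⟩
  have hsI1 : sI = 1 ∨ sI = -1 := by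
    rw [← hsI]
    split_ifs
    · exact Or.inl rfl
    · exact Or.inr rfl
  have hd : Odd (WithZero.log (Valued.v π)) := odd_log_valued_of_eq_exp_neg_one L hπ
  have hs₀eq : ((hilbertSymbol (v.adicCompletion ↥(maximalRealSubfield L)) (-1) π : ℤ) : ℂ) = sI := by
    rw [← hsI]
    have hneg : IsUnit (-1 : Valued.integer (v.adicCompletion ↥(maximalRealSubfield L))) := isUnit_one.neg
    have hbr := ite_isSquare_residue_toPlace_eq_of_ramified L (IsCMField.complexConj L) hc1 v w hw he (-1)
    have hm1 : (⟨toPlace v w ((-1 : Valued.integer (v.adicCompletion ↥(maximalRealSubfield L))) : v.adicCompletion ↥(maximalRealSubfield L)),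
        toPlace_mem_integer L v w (-1)⟩ : 𝒪[(w.1.adicCompletion L)]) = -1 :=
      Subtype.ext (by simp only [NegMemClass.coe_neg, OneMemClass.coe_one, map_neg, map_one])
    rw [hm1] at hbr
    rw [hbr]
    have h₁ := hilbertSymbol_coe_eq_one_iff_isSquare_residue_of_odd ↥(maximalRealSubfield L) v h2O hneg hd
    have h₂ := hilbertSymbol_coe_eq_neg_one_iff_not_isSquare_residue_of_odd ↥(maximalRealSubfield L) v h2O hneg hd
    simp only [NegMemClass.coe_neg, OneMemClass.coe_one] at h₁ h₂
    by_cases hsq : IsSquare (IsLocalRing.residue (Valued.integer (v.adicCompletion ↥(maximalRealSubfield L))) (-1))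
    · rw [if_pos hsq, h₁.2 hsq, Int.cast_one]
    · rw [if_neg hsq, h₂.2 hsq, Int.cast_neg, Int.cast_one]
  have hsIk : ∀ k : ℕ, (sI ^ k)⁻¹ = sI ^ k := by
    intro k
    rcases hsI1 with h | h
    · rw [h, one_pow, inv_one]
    · rw [h, ← inv_pow, inv_neg_one]
  rw [hsI]
  refine ⟨ϖE, 2 * M₀ + 1, _, hϖEv, hσϖE, hE₀, fun εD hεD t ht hN => ?_⟩
  -- the torus point
  obtain ⟨hn1, hPt⟩ := normOne_frame_of_mem_centralizer L v w hw t₀ P d ht₀ hP hd1 _ t.2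
  -- the D-side spec at OUR `t` (instantiated BEFORE the abbreviations, so that `set` rewrites it too)
  have hεD₀ := hεD t ht
  clear hεD
  set a : LocalRing L v := ((P⁻¹).val * ((t : ((cmDatum L 2 (Matrix.of fun i j : Fin 2 => if i.val + j.val + 1 = 2 then (1 : L) else 0)).Local v × (cmDatum L 1 (Matrix.of fun i j : Fin 1 => if i.val + j.val + 1 = 1 then (1 : L) else 0)).Local v)).1.val.val : Matrix (Fin 2) (Fin 2) (LocalRing L v)) * P.val) 0 0 with hadef
  set c : LocalRing L v := ((P⁻¹).val * ((t : ((cmDatum L 2 (Matrix.of fun i j : Fin 2 => if i.val + j.val + 1 = 2 then (1 : L) else 0)).Local v × (cmDatum L 1 (Matrix.of fun i j : Fin 1 => if i.val + j.val + 1 = 1 then (1 : L) else 0)).Local v)).1.val.val : Matrix (Fin 2) (Fin 2) (LocalRing L v)) * P.val) 1 1 with hcdef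
  have hxu : IsUnit (a - c) := isUnit_frameDiff_of_isRegularElt L v w hw t₀ P d ht₀ hP hd1 t ht
  have hx0 : (a - c) w ≠ 0 := (hxu.map (Pi.evalRingHom (fun w' : PlacesOver L v => w'.1.adicCompletion L) w)).ne_zero
  have hva : Valued.v (a w) = 1 := valued_apply_eq_one_of_conjLocal_mul_self L v w hw (hn1 0)
  have hvc : Valued.v (c w) = 1 := valued_apply_eq_one_of_conjLocal_mul_self L v w hw (hn1 1)
  have hc0 : c w ≠ 0 := fun h0 => by rw [h0, map_zero] at hvc; exact zero_ne_one hvc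
  -- the depth `N` and `|a_w − c_w| = exp(−N)`
  set N : ℕ := (-WithZero.log (Valued.v ((a - c) w))).toNat with hNdef
  have hvx0 : Valued.v ((a - c) w) ≠ 0 := (Valuation.ne_zero_iff _).2 hx0
  have hvxle : Valued.v ((a - c) w) ≤ 1 := by
    rw [Pi.sub_apply]
    exact (Valuation.map_sub_le _ hva.le hvc.le)
  have hlogle : WithZero.log (Valued.v ((a - c) w)) ≤ 0 := by
    rwa [← WithZero.log_one, WithZero.log_le_log hvx0 one_ne_zero]
  have hvx : Valued.v ((a - c) w) = WithZero.exp (-(N : ℤ)) := by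
    rw [hNdef, Int.toNat_of_nonneg (by linarith), neg_neg, WithZero.exp_log hvx0]
  have hN1 : 1 ≤ N := le_trans (by omega) hN
  -- `z := a_w ∕ c_w`
  have hσa : (galAdicCompletionMap (L := L) (IsCMField.complexConj L) hw) (a w) * a w = 1 := by
    have h := congrArg (fun f : LocalRing L v => f w) (hn1 0)
    simpa only [Pi.mul_apply, Pi.one_apply, conjLocal_apply_eq_galAdicCompletionMap L v w hw, Matrix.cons_val_zero] using h
  have hσc : (galAdicCompletionMap (L := L) (IsCMField.complexConj L) hw) (c w) * c w = 1 := by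
    have h := congrArg (fun f : LocalRing L v => f w) (hn1 1)
    simpa only [Pi.mul_apply, Pi.one_apply, conjLocal_apply_eq_galAdicCompletionMap L v w hw, Matrix.cons_val_one, Matrix.head_cons,
      Matrix.cons_val_fin_one] using h
  have hz : (galAdicCompletionMap (L := L) (IsCMField.complexConj L) hw) (a w / c w) * (a w / c w) = 1 := by
    rw [map_div₀, div_mul_div_comm, hσa, hσc, div_one]
  have hzsub : a w / c w - 1 = (a - c) w / c w := by rw [Pi.sub_apply]; field_simp
  have hz1' : a w / c w - 1 ≠ 0 := by rw [hzsub]; exact div_ne_zero hx0 hc0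
  have hvz1 : Valued.v (a w / c w - 1) = WithZero.exp (-(N : ℤ)) := by rw [hzsub, map_div₀, hvc, div_one, hvx]
  have hvz1lt : Valued.v (a w / c w - 1) < 1 := by
    rw [hvz1, ← WithZero.exp_zero, WithZero.exp_lt_exp]; omega
  have hvzp : Valued.v (a w / c w + 1) = 1 := by
    have h : a w / c w + 1 = (a w / c w - 1) + 2 := by ring
    rw [h, Valuation.map_add_eq_of_lt_right _ (by rw [h2]; exact hvz1lt), h2]
  have hz1 : a w / c w + 1 ≠ 0 := fun h0 => by rw [h0, map_zero] at hvzp; exact zero_ne_one hvzp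
  -- the Cayley parameter `b₀`, `ι_w b₀ = (z−1)∕((z+1)ϖE)`
  obtain ⟨b₀, hb⟩ := exists_units_toPlace_eq_cayley_div L v w hw hσϖE hϖE0 hz hz1 hz1'
  -- depth: `|a_w − c_w| ≤ |2 ι_w ϖ_v^{M₀}|`
  have hdeep : Valued.v (a w - c w) ≤
      Valued.v (2 * (toPlace v w (HeckeCharacter.uniformizer ↥(maximalRealSubfield L) v : v.adicCompletion ↥(maximalRealSubfield L))) ^ M₀) := by
    rw [← Pi.sub_apply, hvx, map_mul, h2, one_mul, map_pow, (valued_toPlace_uniformizer_of_ramified L (IsCMField.complexConj L) hc1 w hw he).1,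
      ← WithZero.exp_nsmul, WithZero.exp_le_exp, nsmul_eq_mul]
    omega
  have hA := hcore a c b₀ (hn1 1) hdeep hb
  -- valuation of `b₀`: `|ι_w b₀| = exp(−(N−1))`, so `N = 2k+1` and `|b₀| = |π|^k`
  have hvιb : Valued.v (toPlace v w (b₀ : v.adicCompletion ↥(maximalRealSubfield L))) = WithZero.exp (-((N : ℤ) - 1)) := by
    rw [hb, map_div₀, map_mul, hvz1, hvzp, one_mul, hϖEv, ← WithZero.exp_sub]
    congr 1; ring
  have hvb0 : Valued.v (b₀ : v.adicCompletion ↥(maximalRealSubfield L)) ≠ 0 := (Valuation.ne_zero_iff _).2 b₀.ne_zero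
  set m : ℤ := WithZero.log (Valued.v (b₀ : v.adicCompletion ↥(maximalRealSubfield L))) with hmdef
  have hNm : (N : ℤ) - 1 = -(2 * m) := by
    have h := hvιb
    rw [valued_toPlace, he2, ← WithZero.exp_log hvb0, ← WithZero.exp_nsmul, WithZero.exp_inj, nsmul_eq_mul] at h
    push_cast at h
    linarith
  obtain ⟨k, hk⟩ : ∃ k : ℕ, (k : ℤ) = -m := ⟨(-m).toNat, Int.toNat_of_nonneg (by omega)⟩
  have hNk : N = 2 * k + 1 := by omega
  have hNk' : (N - 1) / 2 = k := by omega
  have hvb : Valued.v (b₀ : v.adicCompletion ↥(maximalRealSubfield L)) = Valued.v π ^ k := by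
    rw [← WithZero.exp_log hvb0, hπ, ← WithZero.exp_nsmul, nsmul_eq_mul, ← hmdef]
    congr 1; omega
  obtain ⟨β, hβu, hb₀eq⟩ := exists_eq_pow_mul_coe_unit (K := ↥(maximalRealSubfield L)) v hπ0 k hvb
  have hβ0 : (β : v.adicCompletion ↥(maximalRealSubfield L)) ≠ 0 := fun h0 => by
    apply b₀.ne_zero; rw [hb₀eq, h0, mul_zero]
  -- the Δ-side symbol: `(b₀, θ) = (b₀, π) = s₀^k · (β, π)`, `(β, π) = [res_v β] = [res_w ι_w β]`
  have hsym : ((hilbertSymbol (v.adicCompletion ↥(maximalRealSubfield L)) (b₀ : v.adicCompletion ↥(maximalRealSubfield L))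
      (algebraMap ↥(maximalRealSubfield L) _ ((cmQuadraticGenerator L : 𝓞 ↥(maximalRealSubfield L)) : ↥(maximalRealSubfield L))) : ℤ) : ℂ) =
      ((hilbertSymbol (v.adicCompletion ↥(maximalRealSubfield L)) (-1) π : ℤ) : ℂ) ^ k *
        (if IsSquare (IsLocalRing.residue 𝒪[(w.1.adicCompletion L)] ⟨toPlace v w (β : v.adicCompletion ↥(maximalRealSubfield L)), toPlace_mem_integer L v w β⟩) then (1 : ℂ) else -1) := by
    rw [hsymb, hb₀eq, hilbertSymbol_pow_mul_self_right ↥(maximalRealSubfield L) v hπ0 hβ0 k,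
      ite_isSquare_residue_toPlace_eq_of_ramified L (IsCMField.complexConj L) hc1 v w hw he β]
    push_cast
    congr 1
    by_cases hsq : IsSquare (IsLocalRing.residue (Valued.integer (v.adicCompletion ↥(maximalRealSubfield L))) β)
    · rw [if_pos hsq, (hilbertSymbol_coe_eq_one_iff_isSquare_residue_of_odd ↥(maximalRealSubfield L) v h2O hβu hd).2 hsq, Int.cast_one]
    · rw [if_neg hsq, (hilbertSymbol_coe_eq_neg_one_iff_not_isSquare_residue_of_odd ↥(maximalRealSubfield L) v h2O hβu hd).2 hsq, Int.cast_neg, Int.cast_one]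
  -- the Cayley relation in `L_w`: `ι_w β · ((z+1)·c_w) = u`, `u := (a−c)_w · ϖE^{−N}`
  set u : (w.1.adicCompletion L) := (a - c) w * ((ϖE : (w.1.adicCompletion L)) ^ N)⁻¹ with hudef
  have hxβ : toPlace v w (b₀ : v.adicCompletion ↥(maximalRealSubfield L)) = (ϖE : (w.1.adicCompletion L)) ^ (2 * k) * toPlace v w (β : v.adicCompletion ↥(maximalRealSubfield L)) := by
    rw [hb₀eq, map_mul, map_pow, hιπ, ← pow_mul]
  have hux : a w - c w = (ϖE : (w.1.adicCompletion L)) ^ (2 * k + 1) * u := by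
    rw [hudef, ← Pi.sub_apply, ← hNk, mul_left_comm, mul_inv_cancel₀ (pow_ne_zero _ hϖE0), mul_one]
  have hcay := cayley_unitPart_mul_eq (K := (w.1.adicCompletion L)) (x := toPlace v w (b₀ : v.adicCompletion ↥(maximalRealSubfield L))) (a := a w) (c := c w) (α := (ϖE : (w.1.adicCompletion L)))
    (ϖ := (ϖE : (w.1.adicCompletion L))) (g := 1) (β := toPlace v w (β : v.adicCompletion ↥(maximalRealSubfield L))) (u := u) (k := k)
    (by rw [hb, mul_comm ((a w / c w + 1)) _]) (by rw [mul_one]) hxβ hux hc0 hϖE0 one_ne_zero hz1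
  -- integrality of the tokens in `𝒪[L_w]`
  have hvu : Valued.v u = 1 := by
    rw [hudef, map_mul, map_inv₀, map_pow, hvx, hϖEv, ← WithZero.exp_nsmul, nsmul_eq_mul, mul_neg, mul_one, ← WithZero.exp_neg, neg_neg,
      ← WithZero.exp_add]
    norm_num
  have huO : u ∈ 𝒪[(w.1.adicCompletion L)] := (v_le_one_iff_mem_integer u).1 hvu.le
  have hcO : c w ∈ 𝒪[(w.1.adicCompletion L)] := (v_le_one_iff_mem_integer _).1 hvc.le
  have hz1O : a w / c w + 1 ∈ 𝒪[(w.1.adicCompletion L)] := (v_le_one_iff_mem_integer _).1 hvzp.le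
  have huU : IsUnit (⟨u, huO⟩ : 𝒪[(w.1.adicCompletion L)]) := isUnit_integer_of_v_eq_one w.1 hvu
  have hcU : IsUnit (⟨c w, hcO⟩ : 𝒪[(w.1.adicCompletion L)]) := isUnit_integer_of_v_eq_one w.1 hvc
  have hz1m : (⟨a w / c w + 1, hz1O⟩ : 𝒪[(w.1.adicCompletion L)]) - 2 ∈ IsLocalRing.maximalIdeal 𝒪[(w.1.adicCompletion L)] := by
    rw [← IsLocalRing.residue_eq_zero_iff, residue_eq_zero_iff_valuation_lt_one, ← v_lt_one_iff_valuation_lt_one]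
    change Valued.v (a w / c w + 1 - 2) < 1
    rw [show a w / c w + 1 - 2 = a w / c w - 1 by ring]
    exact hvz1lt
  have hrel : (⟨toPlace v w (β : v.adicCompletion ↥(maximalRealSubfield L)), toPlace_mem_integer L v w β⟩ : 𝒪[(w.1.adicCompletion L)]) *
      ((⟨a w / c w + 1, hz1O⟩ : 𝒪[(w.1.adicCompletion L)]) * ⟨c w, hcO⟩ * 1) = ⟨u, huO⟩ :=
    Subtype.ext (by simp only [MulMemClass.coe_mul, OneMemClass.coe_one]; exact hcay)
  have hsign := ite_isSquare_residue_mul_neg_one_pow_eq_of_cayley (F := (w.1.adicCompletion L)) h2Ow hrel hz1m huU hcU isUnit_one hθ₀ 0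
  simp only [pow_zero, one_mul, mul_one] at hsign
  -- the D-side spec at `S := c_w · u · θ₀`
  have hS : ((⟨c w, hcO⟩ * ⟨u, huO⟩ * θ₀ : 𝒪[(w.1.adicCompletion L)]) : (w.1.adicCompletion L)) = c w * u * (θ₀ : (w.1.adicCompletion L)) := by
    simp only [MulMemClass.coe_mul]
  have hεDt : εD t = if IsSquare (IsLocalRing.residue 𝒪[(w.1.adicCompletion L)] (⟨c w, hcO⟩ * ⟨u, huO⟩ * θ₀)) then (1 : ℂ) else -1 := hεD₀ _ hS
  -- `√∏ = q^{−k} (√q)⁻¹`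
  have hlog : WithZero.log (Valued.v ((a - c) w)) = -((2 * k + 1 : ℕ) : ℤ) := by rw [hvx, WithZero.log_exp, hNk]
  have hsqrt := sqrt_prod_norm_eq_of_log_eq_neg_odd L v w hw he (x := a - c) hx0 hlog
  -- assemble (`simp only`, not `rw`: reducible matching keeps `finHeckeValue`∕the frame entries opaque)
  simp only [hNk', hεDt, hsqrt, hA, hsym, hs₀eq, mul_pow, mul_inv, hsIk, ← hsign]
  push_cast
  ring

end Torus

end Literature.NumberTheory.Rogawski1990

end
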